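import Mathlib.MeasureTheory.Measure.Prod
import Mathlib.MeasureTheory.Measure.Real
import Literature.Probability.Percolation.VoronoiCrossing
import Literature.Analysis.FunctionSpaces.PoissonPointProcessUniqueness
import HarnessLib

/-!
# Colour symmetry of annealed Poisson–Voronoi percolation at `p = 1/2`

Topic `Probability/Percolation`.  The black/white symmetry entering Bollobás–Riordan's proof of
`P_{1/2}(H(S)) = 1/2` (*Percolation* (2006), Ch. 8, Corollary 13, p. 275: "Flipping the states of
all sites … `P_p(V_w(S)) = P_{1-p}(V_b(S))`.  From the symmetry of the Poisson process …"), in the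
annealed two-process form used by the tree (`VoronoiCrossing.lean`, `VoronoiArmEstimates.lean`):
the nuclei are a pair `c = (B, W) : PointConfig ℂ × PointConfig ℂ` under a product law `PB.prod PW`
of two Poisson processes of the SAME σ-finite intensity `ν` (for the route `CardyFlipRusso`,
`ν = volume`).  By Rényi uniqueness (`IsPoissonPointProcess.unique_holds`) `PB = PW`, and the
product of a measure with itself is invariant under the coordinate swap (`Measure.prod_swap`), so
**every event has the same probability as its colour-swapped copy** — for ALL sets, measurable or
not (`Measure.real` is the outer measure, and the swap is a measurable equivalence):

* `measureReal_preimage_swap_prod_self` — `(P.prod P).real (Prod.swap ⁻¹' s) = (P.prod P).real s`;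
* `IsPoissonPointProcess.measureReal_preimage_swap_prod`,
  `IsPoissonPointProcess.measureReal_setOf_swap` — the same for `PB.prod PW`, `PB`, `PW` Poisson of
  one intensity;
* `voronoiCrossing_comm` — a crossing from `A` to `A'` is a crossing from `A'` to `A`;
* `IsPoissonPointProcess.measureReal_voronoiCrossing_swap` — the annealed probability of a WHITE
  crossing (`voronoiCrossing Ω A A' δ W B`: points at least as close to a white nucleus as to a
  black one, ties both colours) equals that of the black crossing of the same arcs.

This is the input "(S)" of the boundary values `f^{i+1} + f^{i+2} → 1` of Smirnov's argument run
for annealed Voronoi percolation (crux `Target` of route `CardyFlipRusso`, line `Sketch`, stub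
`stub_voronoiBoundarySum`; Bollobás–Riordan Ch. 7 p. 201 via Ch. 8 Lemma 12/Cor. 13); the other
input, continuum colour DUALITY in a Jordan domain, is not addressed here.  No named fact is
introduced; Mathlib (`Measure.prod_swap`, `MeasurableEquiv.map_apply`) and the tree's Rényi
uniqueness only.

## References

* B. Bollobás, O. Riordan, *Percolation*, Cambridge University Press (2006), Ch. 8, Lemma 12 and
  Corollary 13, p. 275. [BollobasRiordan2006]
* A. Rényi, *Remarks on the Poisson process*, Studia Sci. Math. Hungar. 2 (1967). [Renyi1967]
-/

noncomputable section

open MeasureTheory Set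

namespace Literature.Probability.Percolation

/-! ### Swap invariance of the product of a measure with itself -/

section Swap

variable {α : Type*} [MeasurableSpace α]

/-- The product `P ⊗ P` of an s-finite measure with itself gives every set the same (outer)
measure as its image under the coordinate swap: `Prod.swap` is a measurable equivalence, so
`Measure.map` along it is computed on all sets, and `map Prod.swap (P.prod P) = P.prod P`
(`Measure.prod_swap`). [folklore] -/
theorem measure_preimage_swap_prod_self (P : Measure α) [SFinite P] (s : Set (α × α)) :
    P.prod P (Prod.swap ⁻¹' s) = P.prod P s := by
  have h : (P.prod P).map (MeasurableEquiv.prodComm : α × α ≃ᵐ α × α) s =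
      P.prod P ((MeasurableEquiv.prodComm : α × α ≃ᵐ α × α) ⁻¹' s) :=
    MeasurableEquiv.map_apply _ _
  have hcoe : ((MeasurableEquiv.prodComm : α × α ≃ᵐ α × α) : α × α → α × α) = Prod.swap := rfl
  rw [hcoe, Measure.prod_swap] at h
  exact h.symm

/-- `Measure.real` version of `measure_preimage_swap_prod_self`. [folklore] -/
theorem measureReal_preimage_swap_prod_self (P : Measure α) [SFinite P] (s : Set (α × α)) :
    (P.prod P).real (Prod.swap ⁻¹' s) = (P.prod P).real s := by
  simp only [Measure.real, measure_preimage_swap_prod_self]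

end Swap

/-! ### Colour symmetry for two Poisson processes of one intensity -/

section Poisson

open Literature.Analysis.FunctionSpaces

variable {E : Type*} [TopologicalSpace E] [MeasurableSpace E] {ν : Measure E} [SigmaFinite ν]
  {PB PW : Measure (PointConfig E)}

/-- **Colour symmetry** (Bollobás–Riordan, Ch. 8, proof of Corollary 13: "from the symmetry of the
Poisson process"): if the black and the white nuclei are Poisson processes of the same σ-finite
intensity, the joint law `PB.prod PW` gives every event the same (outer) probability as its
colour-swapped copy.  (`PB = PW` by Rényi uniqueness, then `measure_preimage_swap_prod_self`.)
[cite: BollobasRiordan2006, Ch. 8 Cor. 13 p. 275] -/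
theorem _root_.Literature.Analysis.FunctionSpaces.IsPoissonPointProcess.measure_preimage_swap_prod
    (hB : IsPoissonPointProcess ν PB) (hW : IsPoissonPointProcess ν PW)
    (s : Set (PointConfig E × PointConfig E)) :
    PB.prod PW (Prod.swap ⁻¹' s) = PB.prod PW s := by
  have hBW : PB = PW := IsPoissonPointProcess.unique_holds hB hW
  subst hBW
  haveI := hB.isProbabilityMeasure
  exact measure_preimage_swap_prod_self PB s

/-- `Measure.real` version of the colour symmetry. [cite: BollobasRiordan2006, Ch. 8 Cor. 13 p. 275] -/
theorem _root_.Literature.Analysis.FunctionSpaces.IsPoissonPointProcess.measureReal_preimage_swap_prod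
    (hB : IsPoissonPointProcess ν PB) (hW : IsPoissonPointProcess ν PW)
    (s : Set (PointConfig E × PointConfig E)) :
    (PB.prod PW).real (Prod.swap ⁻¹' s) = (PB.prod PW).real s := by
  simp only [Measure.real, hB.measure_preimage_swap_prod hW]

/-- Colour symmetry for events given by a predicate of the two nucleus sets: the event
`{c | p c.2 c.1}` (the predicate read with colours exchanged) has the same annealed probability as
`{c | p c.1 c.2}`. [cite: BollobasRiordan2006, Ch. 8 Cor. 13 p. 275] -/
theorem _root_.Literature.Analysis.FunctionSpaces.IsPoissonPointProcess.measureReal_setOf_swap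
    (hB : IsPoissonPointProcess ν PB) (hW : IsPoissonPointProcess ν PW)
    (p : PointConfig E → PointConfig E → Prop) :
    (PB.prod PW).real {c | p c.2 c.1} = (PB.prod PW).real {c | p c.1 c.2} := by
  rw [← hB.measureReal_preimage_swap_prod hW {c | p c.1 c.2}]
  rfl

end Poisson

/-! ### White crossings are as likely as black crossings -/

section Crossing

open Literature.Analysis.FunctionSpaces

variable {Ω A A' B W : Set ℂ} {δ : ℝ}

/-- A crossing between two arcs can be read in either direction (reverse the path). [folklore] -/
theorem voronoiCrossing_comm : voronoiCrossing Ω A A' δ B W ↔ voronoiCrossing Ω A' A δ B W := by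
  constructor
  · rintro ⟨x, hx, y, hy, hJ⟩
    exact ⟨y, hy, x, hx, hJ.symm⟩
  · rintro ⟨y, hy, x, hx, hJ⟩
    exact ⟨x, hx, y, hy, hJ.symm⟩

/-- **White crossings are as likely as black ones** (annealed, equal intensities): for two Poisson
processes `PB`, `PW` of the same σ-finite intensity on `ℂ`, the probability under `PB.prod PW` of a
WHITE crossing of `closure Ω` from `A` to `A'` at mesh `δ` — a path of points at least as close to
a white nucleus as to a black one, `voronoiCrossing Ω A A' δ W B` — equals that of a black
crossing, `voronoiCrossing Ω A A' δ B W` (Bollobás–Riordan's `P_p(V_w) = P_{1-p}(V_b)` at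
`p = 1/2`, in the two-process model). [cite: BollobasRiordan2006, Ch. 8 Cor. 13 p. 275] -/
theorem _root_.Literature.Analysis.FunctionSpaces.IsPoissonPointProcess.measureReal_voronoiCrossing_swap
    {ν : Measure ℂ} [SigmaFinite ν] {PB PW : Measure (PointConfig ℂ)}
    (hB : IsPoissonPointProcess ν PB) (hW : IsPoissonPointProcess ν PW)
    (Ω A A' : Set ℂ) (δ : ℝ) :
    (PB.prod PW).real {c | voronoiCrossing Ω A A' δ (c.2 : Set ℂ) (c.1 : Set ℂ)} =
      (PB.prod PW).real {c | voronoiCrossing Ω A A' δ (c.1 : Set ℂ) (c.2 : Set ℂ)} :=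
  hB.measureReal_setOf_swap hW fun b w => voronoiCrossing Ω A A' δ (b : Set ℂ) (w : Set ℂ)

end Crossing

end Literature.Probability.Percolation

end
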